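import Mathlib
import Literature.NumberTheory.LFunctions.Zhang2022.SkeletonPartThree
import HarnessLib

/-!
# Zhang (2022) §15 p. 88: the phases `P₄^{β₃−βⱼ} = 1, −1, 1 + O(α𝓛³)` behind the values `ℛ₁*ℛ₁ⱼ`

Topic `Literature/NumberTheory/LFunctions/Zhang2022` (Landau–Siegel audit tree; verdict-neutral).
Y. Zhang, *Discrete mean estimates and the Landau–Siegel zero*, arXiv:2211.02515v1 (2022)
[Zhang2022LandauSiegel] — an unrefereed manuscript under adjudication (cell siegel-zhang, D-0069,
discharge lane, node `Skeleton.Ded1524`). §15 p. 88 (tex L4376–L4392) evaluates `ℛ₁*ℛ₁₁ = 1`,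
`ℛ₁*ℛ₁₂ = 2`, `ℛ₁*ℛ₁₃ = 1` "by direct calculation" from `ℛ₁* = β₁β₂L′(1,χ) + O(𝓛⁻²⁴)` and
`ℛ₁ⱼ = P₄^{β₃−βⱼ}/((β_{j+1}−βⱼ)(β_{j+2}−βⱼ)L′(1,χ)) + O(𝓛⁻³)`. The unimodular factor `P₄^{β₃−βⱼ}`
(`P₄ = PT⁻²t₀`, §6 p. 12; `β₁ = iα(1−5c′α𝓛)`, `β₂ = 2iα(1+c′α𝓛)`, `β₃ = 3iα(1−c′α𝓛)`, (2.13);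
`α = π/log P`, `P = e^{𝓛⁹}`) is here computed in the kernel: `log P₄ = 𝓛⁹ − 2𝓛^{1.1} + 519 log 𝓛`
(`log_P4`), hence `|log P₄ − 𝓛⁹| ≤ 521𝓛²` (`abs_log_P4_sub_le`), and for a real `y` with
`|y − kα| ≤ c₁α²𝓛` one has `‖P₄^{iy} − (−1)^k‖ ≤ (c₁(π+521) + 521|k|)·α𝓛³` (`norm_P4_cpow_sub_le`,
via `α𝓛⁹ = π` and `|e^{iθ} − e^{ikπ}| ≤ |θ − kπ|`); in particular (`P4_phases`)
`‖P₄^{β₃−β₁} − 1‖ ≤ (2|c′|(π+521) + 1042)α𝓛³`, `‖P₄^{β₃−β₂} + 1‖ ≤ (5|c′|(π+521) + 521)α𝓛³`,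
`|P₄^{β₃−β₁}| = |P₄^{β₃−β₂}| = 1` (`α𝓛³ = π𝓛⁻⁶`). Companion files: `Section15RhoAlgebra` (the
ratios of the `β`'s and the pointwise product bound), `Section15RhoProductsRate` (the eventual
statement `ℛ₁*ℛ₁ⱼ = (1,2,1)ⱼ + O(𝓛⁻⁵)`), `Section15Eval1524` (the step to (15.24)).

WHAT THIS IS NOT: any claim about Theorems 1–2 of the manuscript or Landau–Siegel zeros; not a
proof of u058/u059 (the values of `ℛ₁*`, `ℛ₁ⱼ`, CLAIM nodes `Typed.Section15C.Step15_u058/059`).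

## References
* Y. Zhang, arXiv:2211.02515v1 (2022), §15 p. 88; §2 (2.6)–(2.13); §6 p. 12 (`P₄`, `T`).
  [cite: Zhang2022LandauSiegel, §15 p.88]
-/

noncomputable section

open Complex Real ComplexConjugate
open Literature.NumberTheory.LFunctions.Zhang2022.Skeleton

namespace Literature.NumberTheory.LFunctions.Zhang2022.Ded1524

/-! ## 1. Phases: `x^{iy}` against `(−1)^k`, and `log P₄ = 𝓛⁹ + O(𝓛²)` -/

/-- `‖x^{iy} − (−1)^k‖ ≤ |y·log x − kπ|` for real `x > 0`, `y`, and an integer `k`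
(`x^{iy} = e^{iy log x}`, `(−1)^k = e^{ikπ}`, `|e^{iθ₁} − e^{iθ₂}| ≤ |θ₁ − θ₂|`). [folklore] -/
private theorem norm_cpow_I_mul_sub_le {x : ℝ} (hx : 0 < x) (y : ℝ) (k : ℤ) :
    ‖((x : ℝ) : ℂ) ^ (I * y) - (-1) ^ k‖ ≤ |y * Real.log x - k * π| := by
  have hcpow : ((x : ℝ) : ℂ) ^ (I * y) = Complex.exp (I * (y * Real.log x : ℝ)) := by
    rw [Complex.cpow_def_of_ne_zero (by exact_mod_cast hx.ne'), ← Complex.ofReal_log hx.le]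
    congr 1; push_cast; ring
  have hpow : ((-1 : ℂ)) ^ k = Complex.exp (I * ((k : ℝ) * π : ℝ)) := by
    rw [← Complex.exp_pi_mul_I, ← Complex.exp_int_mul]
    congr 1; push_cast; ring
  have key : ∀ θ₁ θ₂ : ℝ, ‖Complex.exp (I * θ₁) - Complex.exp (I * θ₂)‖ ≤ |θ₁ - θ₂| := by
    intro θ₁ θ₂
    have h1 : Complex.exp (I * θ₁) = Complex.exp (I * θ₂) * Complex.exp (I * (θ₁ - θ₂ : ℝ)) := by
      rw [← Complex.exp_add]; congr 1; push_cast; ring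
    rw [h1, ← mul_sub_one, norm_mul, Complex.norm_exp_I_mul_ofReal, one_mul]
    exact (Real.norm_exp_I_mul_ofReal_sub_one_le).trans (by rw [Real.norm_eq_abs])
  rw [hcpow, hpow]
  exact key _ _

/-- `P₄ > 0` once `𝓛 > 0` (`P₄ = PT⁻²t₀`, `t₀ = 𝓛⁵¹⁹`). [cite: Zhang2022LandauSiegel, §6 p.12] -/
theorem P4_pos {D : ℕ} (hℓ : 0 < ell D) : 0 < P4 D := by
  unfold P4 bigP bigT t0
  positivity

/-- **`log P₄ = 𝓛⁹ − 2𝓛^{1.1} + 519 log 𝓛`** (`P₄ = PT⁻²t₀`, `P = e^{𝓛⁹}`, `T = e^{𝓛^{1.1}}`, `t₀ = 𝓛⁵¹⁹`).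
[cite: Zhang2022LandauSiegel, §6 p.12] -/
theorem log_P4 {D : ℕ} (hℓ : 0 < ell D) :
    Real.log (P4 D) = ell D ^ 9 - 2 * ell D ^ (1.1 : ℝ) + 519 * Real.log (ell D) := by
  have hP : 0 < bigP D := Real.exp_pos _
  have hT : 0 < bigT D ^ 2 := pow_pos (Real.exp_pos _) 2
  have ht : 0 < t0 D := pow_pos hℓ _
  rw [P4, Real.log_mul (div_pos hP hT).ne' ht.ne', Real.log_div hP.ne' hT.ne', bigP, Real.log_exp,
    Real.log_pow, bigT, Real.log_exp, t0, Real.log_pow]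
  push_cast
  ring

/-- `|log P₄ − 𝓛⁹| ≤ 521𝓛²` for `𝓛 ≥ 1` (`𝓛^{1.1} ≤ 𝓛²`, `log 𝓛 ≤ 𝓛 ≤ 𝓛²`).
[cite: Zhang2022LandauSiegel, §6 p.12] -/
theorem abs_log_P4_sub_le {D : ℕ} (hℓ : 1 ≤ ell D) :
    |Real.log (P4 D) - ell D ^ 9| ≤ 521 * ell D ^ 2 := by
  have hℓ0 : 0 < ell D := by linarith
  rw [log_P4 hℓ0]
  have h11 : ell D ^ (1.1 : ℝ) ≤ ell D ^ 2 := by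
    calc ell D ^ (1.1 : ℝ) ≤ ell D ^ (2 : ℝ) :=
          Real.rpow_le_rpow_of_exponent_le hℓ (by norm_num)
      _ = ell D ^ 2 := by norm_cast
  have h11' : 0 ≤ ell D ^ (1.1 : ℝ) := Real.rpow_nonneg hℓ0.le _
  have hlog0 : 0 ≤ Real.log (ell D) := Real.log_nonneg hℓ
  have hlog : Real.log (ell D) ≤ ell D ^ 2 := by
    calc Real.log (ell D) ≤ ell D := (Real.log_le_sub_one_of_pos hℓ0).trans (by linarith)
      _ ≤ ell D ^ 2 := by nlinarith
  rw [abs_le]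
  constructor <;> nlinarith

/-- `α𝓛⁹ = π` (`α = π/log P`, `log P = 𝓛⁹`), for `𝓛 ≠ 0`. [cite: Zhang2022LandauSiegel, §2 (2.10)] -/
private theorem alpha_mul_ell9 {D : ℕ} (hℓ : ell D ≠ 0) : alpha D * ell D ^ 9 = π := by
  rw [alpha, bigP, Real.log_exp, div_mul_cancel₀ _ (pow_ne_zero _ hℓ)]

/-- `0 ≤ α` and `α ≤ 1`, `α𝓛 ≤ 1` once `𝓛 ≥ 2`. [cite: Zhang2022LandauSiegel, §2 (2.10)] -/
theorem alpha_bounds {D : ℕ} (hℓ : 2 ≤ ell D) :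
    0 ≤ alpha D ∧ alpha D ≤ 1 ∧ alpha D * ell D ≤ 1 := by
  have hℓ0 : 0 < ell D := by linarith
  have hα : alpha D = π / ell D ^ 9 := by rw [alpha, bigP, Real.log_exp]
  have h9 : (2 : ℝ) ^ 9 ≤ ell D ^ 9 := pow_le_pow_left₀ (by norm_num) hℓ 9
  have h8 : (2 : ℝ) ^ 8 ≤ ell D ^ 8 := pow_le_pow_left₀ (by norm_num) hℓ 8
  have hπ := Real.pi_le_four
  refine ⟨by rw [hα]; positivity, ?_, ?_⟩
  · rw [hα, div_le_one (by positivity)]; linarith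
  · rw [hα, div_mul_eq_mul_div, div_le_one (by positivity)]
    calc π * ell D ≤ 4 * ell D := by gcongr
      _ ≤ ell D ^ 8 * ell D := by gcongr; linarith
      _ = ell D ^ 9 := by ring

/-- **The phase of `P₄^{iy}`**: for `𝓛 ≥ 2`, a real `y` and an integer `k` with `|y − kα| ≤ c₁α²𝓛`,
`‖P₄^{iy} − (−1)^k‖ ≤ (c₁(π + 521) + 521|k|)·α𝓛³` — since `y·log P₄ − kπ = (y − kα)log P₄ +
kα(log P₄ − 𝓛⁹)` (`α𝓛⁹ = π`) and `|log P₄ − 𝓛⁹| ≤ 521𝓛²`. This is the computation behind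
"`P₄^{β₃−βⱼ}` is `1, −1, 1` up to `O(α𝓛^{1.1})`" in the values `ℛ₁*ℛ₁ⱼ` of §15 p.88.
[cite: Zhang2022LandauSiegel, §15 p.88] -/
theorem norm_P4_cpow_sub_le {D : ℕ} (hℓ : 2 ≤ ell D) {y c₁ : ℝ} {k : ℤ} (hc₁ : 0 ≤ c₁)
    (hy : |y - k * alpha D| ≤ c₁ * alpha D ^ 2 * ell D) :
    ‖((P4 D : ℝ) : ℂ) ^ (I * y) - (-1) ^ k‖ ≤ (c₁ * (π + 521) + 521 * |(k : ℝ)|) * (alpha D * ell D ^ 3) := by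
  have hℓ1 : 1 ≤ ell D := by linarith
  have hℓ0 : 0 < ell D := by linarith
  obtain ⟨hα0, hα1, hαℓ⟩ := alpha_bounds hℓ
  have hπ9 : alpha D * ell D ^ 9 = π := alpha_mul_ell9 hℓ0.ne'
  refine (norm_cpow_I_mul_sub_le (P4_pos hℓ0) y k).trans ?_
  have hE := abs_log_P4_sub_le hℓ1
  set Lg : ℝ := Real.log (P4 D) with hLg
  have hphase : y * Lg - k * π = (y - k * alpha D) * Lg + k * alpha D * (Lg - ell D ^ 9) := by
    rw [← hπ9]; ring
  rw [hphase]
  have hLg : |Lg| ≤ ell D ^ 9 + 521 * ell D ^ 2 := by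
    have := abs_le.mp hE
    rw [abs_le]; constructor <;> nlinarith [pow_nonneg hℓ0.le 9]
  have h1 : |(y - k * alpha D) * Lg| ≤ c₁ * (π + 521) * (alpha D * ell D ^ 3) := by
    rw [abs_mul]
    calc |y - k * alpha D| * |Lg| ≤ (c₁ * alpha D ^ 2 * ell D) * (ell D ^ 9 + 521 * ell D ^ 2) :=
          mul_le_mul hy hLg (abs_nonneg _) (by positivity)
      _ = c₁ * (alpha D * ell D ^ 9) * (alpha D * ell D) +
            521 * c₁ * alpha D * (alpha D * ell D ^ 3) := by ring
      _ ≤ c₁ * π * (alpha D * ell D ^ 3) + 521 * c₁ * 1 * (alpha D * ell D ^ 3) := by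
          rw [hπ9]
          have h13 : ell D ≤ ell D ^ 3 := by
            calc ell D = ell D ^ 1 := (pow_one _).symm
              _ ≤ ell D ^ 3 := pow_le_pow_right₀ hℓ1 (by norm_num)
          gcongr
      _ = c₁ * (π + 521) * (alpha D * ell D ^ 3) := by ring
  have h2 : |k * alpha D * (Lg - ell D ^ 9)| ≤ 521 * |(k : ℝ)| * (alpha D * ell D ^ 3) := by
    rw [abs_mul, abs_mul, abs_of_nonneg hα0]
    calc |(k : ℝ)| * alpha D * |Lg - ell D ^ 9| ≤ |(k : ℝ)| * alpha D * (521 * ell D ^ 2) := by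
          gcongr
      _ = 521 * |(k : ℝ)| * (alpha D * ell D ^ 2) := by ring
      _ ≤ 521 * |(k : ℝ)| * (alpha D * ell D ^ 3) := by
          have h23 : ell D ^ 2 ≤ ell D ^ 3 := pow_le_pow_right₀ hℓ1 (by norm_num)
          gcongr
  calc |(y - k * alpha D) * Lg + k * alpha D * (Lg - ell D ^ 9)|
      ≤ |(y - k * alpha D) * Lg| + |k * alpha D * (Lg - ell D ^ 9)| := abs_add_le _ _
    _ ≤ c₁ * (π + 521) * (alpha D * ell D ^ 3) + 521 * |(k : ℝ)| * (alpha D * ell D ^ 3) :=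
        add_le_add h1 h2
    _ = (c₁ * (π + 521) + 521 * |(k : ℝ)|) * (alpha D * ell D ^ 3) := by ring

section Shifts

variable (c' : ℝ) (D : ℕ)

/-- The exponents: `β₃ − β₁ = i·2α(1+θ)` and `β₃ − β₂ = i·α(1−5θ)`, `θ = c′α𝓛`.
[cite: Zhang2022LandauSiegel, §2 (2.13)] -/
theorem beta3_sub :
    beta3 c' D - beta1 c' D = I * (2 * alpha D * (1 + c' * alpha D * ell D) : ℝ) ∧
      beta3 c' D - beta2 c' D = I * (alpha D * (1 - 5 * (c' * alpha D * ell D)) : ℝ) := by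
  constructor
  · rw [beta3, beta1]; push_cast; ring
  · rw [beta3, beta2]; push_cast; ring

end Shifts

section Phases

variable (c' : ℝ) {D : ℕ}

/-- The two phases: `‖P₄^{β₃−β₁} − 1‖ ≤ (2|c′|(π+521) + 1042)α𝓛³`, `‖P₄^{β₃−β₂} + 1‖ ≤
(5|c′|(π+521) + 521)α𝓛³`, and `|P₄^{β₃−β₁}| = |P₄^{β₃−β₂}| = 1`. [cite: Zhang2022LandauSiegel, §15 p.88] -/
theorem P4_phases (hℓ2 : 2 ≤ ell D) :
    ‖((P4 D : ℝ) : ℂ) ^ (beta3 c' D - beta1 c' D) - 1‖ ≤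
        (2 * |c'| * (π + 521) + 1042) * (alpha D * ell D ^ 3) ∧
      ‖((P4 D : ℝ) : ℂ) ^ (beta3 c' D - beta2 c' D) - (-1)‖ ≤
        (5 * |c'| * (π + 521) + 521) * (alpha D * ell D ^ 3) ∧
      ‖((P4 D : ℝ) : ℂ) ^ (beta3 c' D - beta1 c' D)‖ = 1 ∧
      ‖((P4 D : ℝ) : ℂ) ^ (beta3 c' D - beta2 c' D)‖ = 1 := by
  have hℓ0 : 0 < ell D := by linarith
  obtain ⟨hα0, -, -⟩ := alpha_bounds hℓ2
  obtain ⟨x31, x32⟩ := beta3_sub c' D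
  have hP4 := P4_pos hℓ0
  have hα2ℓ : 0 ≤ alpha D ^ 2 * ell D := by positivity
  refine ⟨?_, ?_, ?_, ?_⟩
  · have h := norm_P4_cpow_sub_le hℓ2 (y := 2 * alpha D * (1 + c' * alpha D * ell D))
      (c₁ := 2 * |c'|) (k := 2) (by positivity) (by
        rw [show 2 * alpha D * (1 + c' * alpha D * ell D) - ((2:ℤ):ℝ) * alpha D =
          (2 * c') * (alpha D ^ 2 * ell D) by push_cast; ring, abs_mul, abs_mul, abs_of_nonneg hα2ℓ,
          abs_of_nonneg (by norm_num : (0:ℝ) ≤ 2)]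
        exact le_of_eq (by ring))
    have e : ((-1 : ℂ)) ^ (2 : ℤ) = 1 := by norm_num
    rw [e] at h
    rw [x31]
    refine h.trans (le_of_eq ?_)
    norm_num
  · have h := norm_P4_cpow_sub_le hℓ2 (y := alpha D * (1 - 5 * (c' * alpha D * ell D)))
      (c₁ := 5 * |c'|) (k := 1) (by positivity) (by
        rw [show alpha D * (1 - 5 * (c' * alpha D * ell D)) - ((1:ℤ):ℝ) * alpha D =
          -(5 * c') * (alpha D ^ 2 * ell D) by push_cast; ring, abs_mul, abs_neg, abs_mul,
          abs_of_nonneg hα2ℓ, abs_of_nonneg (by norm_num : (0:ℝ) ≤ 5)]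
        exact le_of_eq (by ring))
    have e : ((-1 : ℂ)) ^ (1 : ℤ) = -1 := by norm_num
    rw [e] at h
    rw [x32]
    refine h.trans (le_of_eq ?_)
    norm_num
  · rw [Complex.norm_cpow_eq_rpow_re_of_pos hP4, x31]; simp
  · rw [Complex.norm_cpow_eq_rpow_re_of_pos hP4, x32]; simp

end Phases

end Literature.NumberTheory.LFunctions.Zhang2022.Ded1524
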